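/-
Copyright: statement-level skeleton of a published paper (lit-balaban cell, Phase-2 proof seat p25, gen 20). No proof
claims beyond what the kernel checks below.
-/
import Literature.MathematicalPhysics.QuantumFieldTheory.BalabanImbrieJaffe1984to88.BIJ88WalkDirectionCount312
import Literature.MathematicalPhysics.QuantumFieldTheory.BalabanImbrieJaffe1984to88.BIJ88WalkIneq312NonVacuity
import Literature.MathematicalPhysics.QuantumFieldTheory.BalabanImbrieJaffe1984to88.BIJ88SlotFieldGaussBounds
import Literature.Probability.Distributions.GaussianMoments

/-!
# `BalabanImbrieJaffe1984to88.BIJ88WalkRemainderMoments312` — T. Bałaban, J. Imbrie, A. Jaffe, *Effective action and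
cluster properties of the abelian Higgs model*, Commun. Math. Phys. **114** (1988) 257–315 [BalabanImbrieJaffe1988],
§5.14 p. 312 [PDF 56], verbatim (x2 render `lit-balaban-r16/renders/cmp114/original-p056-x2.png`, re-read this session):
*"we need to finish the calculation of the remainders by giving a cluster expansion for ⟨Π_r F_{k,rem}(X_r)⟩_1, with
appropriate bounds. … Without going into details, it is clear that the result can be written in the following form"* —
**THE MOMENT LETTER `Λ_O` OF THE HEAD THEOREM DISCHARGED ON THE §5.13 LAW** (p25 gen 20; a MEMBER of row C2.Claim@312:
the head `BIJ88WalkIneq312RemainderBdry.ineq312_remainder_bdry` carries the expectation clause `hE`, which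
`BIJ88WalkRemainderExpectation312.remainder_expectation_le` reduces to a sup letter (`K_χ`, `η_χ`) and a MOMENT LETTER
`Λ_O` — *for every no-block term `t` of `expand 0 O`: `𝔼_W|Π_{w ∈ pending legs of t}(Φ·w)| ≤ Λ_O`* — the Gaussian moments
print leaves to *"Without going into details"*; here the moment letter is PROVED with an explicit `Λ_O`).
* §1 `integral_abs_pow_gaussianReal_le` (`∫|x|^N d𝒩(m,v) ≤ 2^N(|m|^N + 1 + v^N(2N−1)‼)`: `|x| ≤ |m| + |x−m|`,
  `|y|^N ≤ 1 + y^{2N}`, even moments `∫y^{2N}d𝒩(0,v) = v^N(2N−1)‼` of `Literature.Probability.Distributions.GaussianMoments`),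
  `integral_abs_pow_le_of_hasGaussianLaw` (Mathlib `HasGaussianLaw`);
* §2 `prod_abs_le_sum_pow_div` (`Π_{i<N}|a_i| ≤ (1/N)Σ_i|a_i|^N`, Mathlib `Real.geom_mean_le_arith_mean_weighted`),
  `integral_abs_prod_le_of_moments`, `integral_abs_listProd_dotProduct_le`;
* §3 `expand_pend_le_pot` (`Σ_{X∈t.groups}|pend X| ≤ Φ(done, rest)` along `expand`, the potential of `BIJ88WalkTermCount312`
  as for the `χ′`-directions in `BIJ88WalkDirectionCount312`), **`expand_pend_length_le_phi0`** (`≤ Φ₀(O)`);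
* §4 `hasGaussianLaw_dotProduct_fieldLaw` (`Φ ↦ Φ·w` is Gaussian under `fieldLaw`: mean `w·(prec⁻¹ℱ|_W)`, variance
  `w·prec⁻¹w`, `BIJ88SlotFieldGaussBounds`), `integral_abs_dotProduct_pow_fieldLaw_le`, **`remainder_moment_le`** — for
  every no-block term of `expand 0 O` whose observable/vertex legs `w` satisfy `|w·(prec⁻¹ℱ|_W)| ≤ μ_*`, `w·prec⁻¹w ≤ v_*`:
  `𝔼_W|Π_{pending}(Φ·w)| ≤ Λ_O := Σ_{N ≤ Φ₀(O)} 2^N(μ_*^N + 1 + v_*^N(2N−1)‼)`;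
* §5 **`remainder_expectation_le_of_sup`** — the head's clause `hE` from the SUP LETTER ALONE, the moment letter discharged.

statement-level skeleton of published theorems with citation tags; proofs where landed; nothing here is a claim
about the Yang–Mills mass gap

PDF held: `paper:balaban1988-cmp114-bij-abelian-higgs-effective-action` (journal page = PDF page + 256); p. 312 = PDF 56.
CITATION HEADER (lean-in-tree rule).  lit-balaban cell (HOME `run/shared/lean/pub/lit-balaban/`), Phase 2, seat p25
gen 20; row **C2.Claim@312** of `HOME/lit-balaban-r16/ROWS-C2-part2.md` (owner r16, referee ref-5; head theorem of
record v2.284 UNCHANGED; this file is a MEMBER serving clause C3's moment letter ON THE MODEL OF RECORD).  USED BY NAME,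
nothing restated: `BIJ88WalkExpansion311.expand`, `BIJ88WalkTermCount312.{pot, expand_pot_key}`,
`BIJ88WalkDirectionCount312.run_dirs_rpot_le`, `BIJ88WalkIneq312NonVacuity.expand_pend_dir`, `BIJ88WalkIneq312Remainder.phi0`,
`BIJ88WalkRemainderExpectation312.remainder_expectation_le`, `BIJ88EffectiveActionGauss308.isGaussian_fieldLaw`,
`BIJ88SlotFieldGaussBounds.{variance_linear_fieldLaw, integral_linear_fieldLaw_eq_dotProduct, ext_dotProduct_ext}`.
HONEST SCOPE: (a) arithmetic–geometric mean with UNIFORM letters `μ_*`, `v_*` over the legs (Hölder with per-leg norms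
would be sharper; print gives no constant); (b) `μ_*`, `v_*` are closed-form quadratic-form bounds the user supplies (e.g.
from `‖prec⁻¹‖` and the legs' norms); (c) the sup letter `K_χ`, `η_χ` of C3 is untouched (the sup route, not print's shell
mechanism); everything else as in the head's (H1)–(H5).  NOT summit progress; NOT continuum; NOT Clay.  Imports
`BIJ88WalkDirectionCount312`, `BIJ88WalkIneq312NonVacuity`, `BIJ88SlotFieldGaussBounds`,
`Literature.Probability.Distributions.GaussianMoments`; modifies nothing.
-/

noncomputable section

namespace Literature.MathematicalPhysics.QuantumFieldTheory.BalabanImbrieJaffe1984to88.BIJ88WalkRemainderMoments312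

open Classical MeasureTheory ProbabilityTheory Matrix Finset
open scoped BigOperators NNReal
open Literature.Probability.Distributions (integral_pow_even_gaussianReal integrable_pow_gaussianReal)
open Literature.MathematicalPhysics.QuantumFieldTheory.Balaban1983to89
open B2Eq228Conditioning (weight source)
open BIJ88PolymerRep5134 (corner)
open BIJ88PolymerRep5134Gauss (prec src ext)
open BIJ88SlotMomentsGauss308 (fieldLaw isProbabilityMeasure_fieldLaw)
open BIJ88EffectiveActionGauss308 (isGaussian_fieldLaw)
open BIJ88SlotFieldGaussBounds (variance_linear_fieldLaw integral_linear_fieldLaw_eq_dotProduct ext_dotProduct_ext)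
open BIJ88VertexIbp311 (vexp)
open BIJ88WickDerivatives305 (dlist)
open BIJ88VertexComponents311 (maxArity)
open BIJ88LabelledRun311 (mem_mbind)
open BIJ88WalkRun311 BIJ88WalkRunEnv311 BIJ88WalkExpansion311 BIJ88WalkTermCount312 BIJ88WalkDirectionCount312
  BIJ88WalkIneq312Remainder BIJ88WalkRemainderExpectation312 BIJ88WalkIneq312NonVacuity

/-! ## §1  The absolute moments of one Gaussian variable -/

section OneDim

/-- pointwise: `|x|^N ≤ 2^N(|m|^N + |x − m|^N)`. [cite: BalabanImbrieJaffe1988, §5.14 p.312] -/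
theorem abs_pow_le_centred (x m : ℝ) (N : ℕ) : |x| ^ N ≤ 2 ^ N * (|m| ^ N + |x - m| ^ N) := by
  have h1 : |x| ≤ |m| + |x - m| := (congrArg abs (by ring : x = m + (x - m))).trans_le (abs_add_le _ _)
  have h0 := pow_nonneg (abs_nonneg m) N; have h0' := pow_nonneg (abs_nonneg (x - m)) N
  rcases le_total |m| |x - m| with h | h
  · calc |x| ^ N ≤ (2 * |x - m|) ^ N := pow_le_pow_left₀ (abs_nonneg _) (by linarith) N
      _ ≤ 2 ^ N * (|m| ^ N + |x - m| ^ N) := by rw [mul_pow]; nlinarith [pow_nonneg (zero_le_two (α := ℝ)) N]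
  · calc |x| ^ N ≤ (2 * |m|) ^ N := pow_le_pow_left₀ (abs_nonneg _) (by linarith) N
      _ ≤ 2 ^ N * (|m| ^ N + |x - m| ^ N) := by rw [mul_pow]; nlinarith [pow_nonneg (zero_le_two (α := ℝ)) N]

/-- pointwise: `|y|^N ≤ 1 + y^{2N}`. [cite: BalabanImbrieJaffe1988, §5.14 p.312] -/
theorem abs_pow_le_one_add_pow_two_mul (y : ℝ) (N : ℕ) : |y| ^ N ≤ 1 + y ^ (2 * N) := by
  have he : y ^ (2 * N) = |y| ^ (2 * N) := by rw [pow_mul, pow_mul, sq_abs]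
  rw [he]
  rcases le_total |y| 1 with h | h
  · exact (pow_le_one₀ (abs_nonneg _) h).trans (le_add_of_nonneg_right (pow_nonneg (abs_nonneg _) _))
  · exact (pow_le_pow_right₀ h (by omega)).trans (le_add_of_nonneg_left zero_le_one)

/-- **`∫ |x|^N d𝒩(m,v) ≤ 2^N (|m|^N + 1 + v^N (2N−1)‼)`** — the absolute moments of a real Gaussian from its even
central moments `∫ y^{2N} d𝒩(0,v) = v^N(2N−1)‼`. [cite: BalabanImbrieJaffe1988, §5.14 p.312] -/
theorem integral_abs_pow_gaussianReal_le (m : ℝ) (v : ℝ≥0) (N : ℕ) :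
    ∫ x, |x| ^ N ∂(gaussianReal m v) ≤ 2 ^ N * (|m| ^ N + (1 + (v : ℝ) ^ N * ((2 * N - 1).doubleFactorial : ℝ))) := by
  have hmap : (gaussianReal m v).map (fun x => x - m) = gaussianReal 0 v := by
    rw [gaussianReal_map_sub_const, sub_self]
  have hshift : ∫ x, (x - m) ^ (2 * N) ∂(gaussianReal m v) = (v : ℝ) ^ N * ((2 * N - 1).doubleFactorial : ℝ) := by
    rw [← integral_pow_even_gaussianReal v N, ← hmap,
      integral_map (measurable_sub_const m).aemeasurable (by fun_prop)]
  have hint2 : Integrable (fun x : ℝ => (x - m) ^ (2 * N)) (gaussianReal m v) := by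
    have h := integrable_pow_gaussianReal 0 v (2 * N)
    rw [← hmap, integrable_map_measure (by fun_prop) (measurable_sub_const m).aemeasurable] at h
    exact h
  have hint1 : Integrable (fun x : ℝ => (1 : ℝ) + (x - m) ^ (2 * N)) (gaussianReal m v) :=
    (integrable_const _).add hint2
  have hintR : Integrable (fun x : ℝ => |m| ^ N + ((1 : ℝ) + (x - m) ^ (2 * N))) (gaussianReal m v) :=
    (integrable_const _).add hint1
  have hI : ∫ x, |m| ^ N + ((1 : ℝ) + (x - m) ^ (2 * N)) ∂(gaussianReal m v)
      = |m| ^ N + (1 + (v : ℝ) ^ N * ((2 * N - 1).doubleFactorial : ℝ)) := by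
    rw [integral_add (integrable_const _) hint1, integral_add (integrable_const _) hint2, integral_const,
      integral_const, hshift]
    simp
  calc ∫ x, |x| ^ N ∂(gaussianReal m v)
      ≤ ∫ x, 2 ^ N * (|m| ^ N + (1 + (x - m) ^ (2 * N))) ∂(gaussianReal m v) := by
        refine integral_mono_of_nonneg (ae_of_all _ fun x => pow_nonneg (abs_nonneg x) N) (hintR.const_mul _)
          (ae_of_all _ fun x => ?_)
        exact (abs_pow_le_centred x m N).trans (mul_le_mul_of_nonneg_left
          (add_le_add le_rfl (abs_pow_le_one_add_pow_two_mul (x - m) N)) (pow_nonneg zero_le_two _))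
    _ = 2 ^ N * (|m| ^ N + (1 + (v : ℝ) ^ N * ((2 * N - 1).doubleFactorial : ℝ))) := by
        rw [integral_const_mul, hI]

variable {Ω : Type*} [MeasurableSpace Ω] {P : Measure Ω}

/-- **`∫|X|^N ≤ 2^N(|𝔼X|^N + 1 + Var[X]^N(2N−1)‼)`** for a real variable with a Gaussian law (Mathlib `HasGaussianLaw`).
[cite: BalabanImbrieJaffe1988, §5.14 p.312] -/
theorem integral_abs_pow_le_of_hasGaussianLaw {X : Ω → ℝ} (hX : HasGaussianLaw X P) (N : ℕ) :
    ∫ ω, |X ω| ^ N ∂P ≤ 2 ^ N * (|∫ ω, X ω ∂P| ^ N + (1 + (Var[X; P]) ^ N * ((2 * N - 1).doubleFactorial : ℝ))) := by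
  have hmap := hX.map_eq_gaussianReal
  have h1 : ∫ ω, |X ω| ^ N ∂P = ∫ x, |x| ^ N ∂(P.map X) := by
    rw [integral_map hX.aemeasurable (by fun_prop)]
  rw [h1, hmap]
  have hv : ((Var[X; P]).toNNReal : ℝ) = Var[X; P] := Real.coe_toNNReal _ (variance_nonneg X P)
  have h2 := integral_abs_pow_gaussianReal_le (∫ ω, X ω ∂P) (Var[X; P]).toNNReal N
  rwa [hv] at h2

end OneDim

/-! ## §2  Products of legs by the arithmetic–geometric mean -/

section Products

/-- **`Π_{i} |a_i| ≤ (Σ_i |a_i|^N)/N`** for `N = #indices ≥ 1` (the arithmetic–geometric mean inequality with equal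
weights, Mathlib `Real.geom_mean_le_arith_mean_weighted`). [cite: BalabanImbrieJaffe1988, §5.14 p.312] -/
theorem prod_abs_le_sum_pow_div {n : ℕ} (hn : n ≠ 0) (a : Fin n → ℝ) :
    ∏ i, |a i| ≤ (∑ i, |a i| ^ n) / n := by
  have hw : ∑ _i : Fin n, ((n : ℝ)⁻¹) = 1 := by
    rw [sum_const, card_univ, Fintype.card_fin, nsmul_eq_mul, mul_inv_cancel₀ (Nat.cast_ne_zero.2 hn)]
  have h := Real.geom_mean_le_arith_mean_weighted (s := (univ : Finset (Fin n))) (fun _ => (n : ℝ)⁻¹)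
    (fun i => |a i| ^ n) (fun _ _ => inv_nonneg.2 (Nat.cast_nonneg n)) hw (fun i _ => pow_nonneg (abs_nonneg _) _)
  rw [Finset.prod_congr rfl fun i _ => Real.pow_rpow_inv_natCast (abs_nonneg (a i)) hn] at h
  rwa [div_eq_inv_mul, Finset.mul_sum]

variable {Ω : Type*} [MeasurableSpace Ω] {P : Measure Ω}

/-- **`𝔼|Π_{i<N} X_i| ≤ C`** when `𝔼|X_i|^N ≤ C` for every `i` (`N ≥ 1`; integrable `|X_i|^N`).
[cite: BalabanImbrieJaffe1988, §5.14 p.312] -/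
theorem integral_abs_prod_le_of_moments {n : ℕ} (hn : n ≠ 0) {X : Fin n → Ω → ℝ}
    (hint : ∀ i, Integrable (fun ω => |X i ω| ^ n) P) {C : ℝ} (hC : ∀ i, ∫ ω, |X i ω| ^ n ∂P ≤ C) :
    ∫ ω, |∏ i, X i ω| ∂P ≤ C := by
  have hn0 : (0 : ℝ) < n := Nat.cast_pos.2 (Nat.pos_of_ne_zero hn)
  have hintS : Integrable (fun ω => ∑ i, |X i ω| ^ n) P := integrable_finsetSum _ fun i _ => hint i
  calc ∫ ω, |∏ i, X i ω| ∂P ≤ ∫ ω, (∑ i, |X i ω| ^ n) / n ∂P := by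
        refine integral_mono_of_nonneg (ae_of_all _ fun ω => abs_nonneg _) (hintS.div_const _)
          (ae_of_all _ fun ω => ?_)
        simpa only [Finset.abs_prod] using prod_abs_le_sum_pow_div hn fun i => X i ω
    _ = (∑ i, ∫ ω, |X i ω| ^ n ∂P) / n := by rw [integral_div, integral_finsetSum _ fun i _ => hint i]
    _ ≤ (∑ _i : Fin n, C) / n := div_le_div_of_nonneg_right (Finset.sum_le_sum fun i _ => hC i) hn0.le
    _ = C := by rw [sum_const, card_univ, Fintype.card_fin, nsmul_eq_mul]; field_simp

/-- **THE PRODUCT OVER A LIST OF LEGS**: for a probability measure on the fields `S → ℝ` and a nonempty list `L` of legs,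
if `𝔼|Φ·w|^{|L|} ≤ C` (integrably) for every `w ∈ L` then `𝔼|Π_{w∈L}(Φ·w)| ≤ C`. [cite: BalabanImbrieJaffe1988, §5.14 p.312] -/
theorem integral_abs_listProd_dotProduct_le {S : Type} [Fintype S] {P : Measure (S → ℝ)}
    (L : List (S → ℝ)) (hL : L ≠ []) {C : ℝ}
    (hint : ∀ w ∈ L, Integrable (fun φ : S → ℝ => |φ ⬝ᵥ w| ^ L.length) P)
    (hC : ∀ w ∈ L, ∫ φ, |φ ⬝ᵥ w| ^ L.length ∂P ≤ C) :
    ∫ φ, |(L.map fun w => φ ⬝ᵥ w).prod| ∂P ≤ C := by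
  have hn : L.length ≠ 0 := fun h => hL (List.length_eq_zero_iff.1 h)
  have e : ∀ φ : S → ℝ, (L.map fun w => φ ⬝ᵥ w).prod = ∏ i : Fin L.length, φ ⬝ᵥ L.get i := fun φ => by
    conv_lhs => rw [← List.ofFn_get L]
    rw [List.map_ofFn, List.prod_ofFn]; rfl
  simp only [e]
  exact integral_abs_prod_le_of_moments hn (fun i => hint _ (List.get_mem L i)) fun i => hC _ (List.get_mem L i)

end Products

/-! ## §3  The number of pending legs of a term -/

section Count

variable {S : Type} [Fintype S] {ι : Type} [Fintype ι] {κ : Type} [LinearOrder κ] {P : Type} [Fintype P]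
variable {Cov : P → Matrix S S ℝ} {trig : P → Bool} {f : S → ℝ} {c : ι → ℝ} {legs : ι → List (S → ℝ)}
  {obs : κ → List (S → ℝ)} {M : ℕ}

/-- **THE PENDING LEGS OF A TERM ARE PAID FOR BY THE POTENTIAL**: `Σ_{X ∈ t.groups}|pend X| ≤ Φ(done, rest)` for every
term of `expand done rest` (the potential counts the pending legs of the set-aside components, the legs of the
untouched observables and the arity budget of the vertices still allowed). [cite: BalabanImbrieJaffe1988, §5.14 p.311–312] -/
theorem expand_pend_le_pot : ∀ (n : ℕ) (done : Multiset (WGrp S κ ι P)) (rest : Finset κ), rest.card < n →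
    ∀ t ∈ expand Cov trig f c legs obs M done rest,
      (t.groups.map fun h => h.pend.length).sum ≤ pot obs M (maxArity legs) done rest
  | 0, _, _, hn => fun _ _ => absurd hn (Nat.not_lt_zero _)
  | n + 1, done, rest, hn => by
    intro t ht
    by_cases h : rest.Nonempty
    · rw [expand_of_nonempty Cov trig f c legs obs M h, mem_mbind] at ht
      obtain ⟨o, ho, ht⟩ := ht
      have hcard : o.rest.card < n := lt_of_lt_of_le (lt_of_le_of_lt (Finset.card_le_card (run_rest_subset _ _ _ o ho))
        (Finset.card_erase_lt_of_mem (rest.min'_mem h))) (Nat.lt_succ_iff.1 hn)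
      have hrun := run_dirs_rpot_le (Cov := Cov) (trig := trig) (f := f) (c := c) (legs := legs) (obs := obs) (M := M)
        _ _ _ o ho
      split_ifs at ht with hg
      · rw [Multiset.mem_map] at ht
        obtain ⟨t', ht', rfl⟩ := ht
        have IH := expand_pend_le_pot n o.done o.rest hcard t' ht'
        have hkey := expand_pot_key (Cov := Cov) (trig := trig) (f := f) (c := c) (legs := legs) (obs := obs) (M := M)
          h done o ho 0 (Nat.zero_le _)
        simp only [WTerm.addConst, oact_groups]
        omega
      · rw [Multiset.mem_map] at ht
        obtain ⟨t', ht', rfl⟩ := ht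
        have IH := expand_pend_le_pot n (o.g ::ₘ o.done) o.rest hcard t' ht'
        have hkey := expand_pot_key (Cov := Cov) (trig := trig) (f := f) (c := c) (legs := legs) (obs := obs) (M := M)
          h done o ho o.g.pend.length le_rfl
        have e : pot obs M (maxArity legs) (o.g ::ₘ o.done) o.rest
            = o.g.pend.length + pot obs M (maxArity legs) o.done o.rest := by
          simp only [pot, Multiset.map_cons, Multiset.sum_cons]; ring
        simp only [oact_groups]
        omega
    · rw [expand_of_not_nonempty Cov trig f c legs obs M h, Multiset.mem_singleton] at ht
      subst ht
      simp [pot]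

/-- **`Σ_{X∈t.groups}|pend X| ≤ Φ₀(K)`** for every term of `expand 0 K`. [cite: BalabanImbrieJaffe1988, §5.14 p.312] -/
theorem expand_pend_length_le_phi0 (K : Finset κ) :
    ∀ t ∈ expand Cov trig f c legs obs M 0 K, (t.groups.map fun h => h.pend.length).sum ≤ phi0 legs obs M K := by
  intro t ht
  have h := expand_pend_le_pot (Cov := Cov) (trig := trig) (f := f) (c := c) (legs := legs) (obs := obs) (M := M)
    _ 0 K (Nat.lt_succ_self _) t ht
  simpa [pot, phi0] using h

omit [Fintype S] [Fintype ι] [LinearOrder κ] [Fintype P] in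
/-- the pending legs of a term as ONE multiset: its size is `Σ_{X∈t.groups}|pend X|`.
[cite: BalabanImbrieJaffe1988, §5.14 p.312] -/
theorem card_pend_sum (G : Multiset (WGrp S κ ι P)) :
    Multiset.card (G.map fun h => (h.pend : Multiset (S → ℝ))).sum = (G.map fun h => h.pend.length).sum := by
  induction G using Multiset.induction with
  | empty => simp
  | cons g G ih => simp [ih]

end Count

/-! ## §4  On the §5.13 law: the moment letter -/

section Law

variable {ι : Type} [Fintype ι] {κ : Type} [LinearOrder κ] {P : Type} [Fintype P]
variable {α I : Type} [Fintype α] [DecidableEq α] [Fintype I] [DecidableEq I]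
  (blk : α → I) (Δ : Matrix α α ℝ) (ℱ : α → ℝ) (W : Finset I)

/-- the leg functional `Φ ↦ Φ·w` as a continuous linear map. [cite: BalabanImbrieJaffe1988, §5.14 p.312] -/
theorem isLinearMap_dotProduct_right {n : Type} [Fintype n] (w : n → ℝ) : IsLinearMap ℝ fun φ : n → ℝ => φ ⬝ᵥ w :=
  ⟨fun a b => add_dotProduct a b w, fun r a => by rw [smul_dotProduct, smul_eq_mul]⟩

/-- **`Φ ↦ Φ·w` HAS A GAUSSIAN LAW under `fieldLaw`** (the law is a Gaussian measure, `BIJ88EffectiveActionGauss308.isGaussian_fieldLaw`).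
[cite: BalabanImbrieJaffe1988, (5.14.3) p.309; §5.14 p.312] -/
theorem hasGaussianLaw_dotProduct_fieldLaw (hPD : (prec blk Δ W (corner ℝ W)).PosDef) (w : {x : α // blk x ∈ W} → ℝ) :
    HasGaussianLaw (fun φ : {x : α // blk x ∈ W} → ℝ => φ ⬝ᵥ w) (fieldLaw blk Δ ℱ W) := by
  haveI := isGaussian_fieldLaw blk Δ ℱ W hPD
  exact (IsGaussian.hasGaussianLaw_id (μ := fieldLaw blk Δ ℱ W)).map
    (LinearMap.toContinuousLinearMap ((isLinearMap_dotProduct_right w).mk' _))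

/-- the mean and the variance of `Φ·w` under the law: `w·(prec⁻¹ℱ|_W)` and `w·prec⁻¹w`.
[cite: BalabanImbrieJaffe1988, (5.14.3) p.309; §5.14 p.312] -/
theorem integral_and_variance_dotProduct_fieldLaw (hPD : (prec blk Δ W (corner ℝ W)).PosDef)
    (w : {x : α // blk x ∈ W} → ℝ) :
    (∫ φ, φ ⬝ᵥ w ∂(fieldLaw blk Δ ℱ W)) = w ⬝ᵥ ((prec blk Δ W (corner ℝ W))⁻¹ *ᵥ src blk ℱ W) ∧
      Var[fun φ : {x : α // blk x ∈ W} → ℝ => φ ⬝ᵥ w; fieldLaw blk Δ ℱ W]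
        = w ⬝ᵥ ((prec blk Δ W (corner ℝ W))⁻¹ *ᵥ w) := by
  have hℓ : IsLinearMap ℝ fun φ : α → ℝ => φ ⬝ᵥ ext blk W w := isLinearMap_dotProduct_right _
  have e1 : (fun φ : {x : α // blk x ∈ W} → ℝ => (ext blk W φ) ⬝ᵥ ext blk W w) = fun φ => φ ⬝ᵥ w :=
    funext fun φ => ext_dotProduct_ext blk W φ w
  have e2 : (fun x : {x : α // blk x ∈ W} => ext blk W (Pi.single x 1) ⬝ᵥ ext blk W w) = w := by
    funext x; rw [ext_dotProduct_ext, single_dotProduct, one_mul]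
  have hm := integral_linear_fieldLaw_eq_dotProduct blk Δ ℱ W hPD hℓ
  have hv := variance_linear_fieldLaw blk Δ ℱ W hPD hℓ
  rw [e2] at hm hv; simp only [e1] at hm hv; exact ⟨hm, hv⟩

/-- **THE ABSOLUTE MOMENTS OF ONE LEG**: `𝔼_W|Φ·w|^N ≤ 2^N(μ_*^N + 1 + v_*^N(2N−1)‼)` whenever `|w·(prec⁻¹ℱ|_W)| ≤ μ_*` and
`w·prec⁻¹w ≤ v_*`. [cite: BalabanImbrieJaffe1988, §5.14 p.312] -/
theorem integral_abs_dotProduct_pow_fieldLaw_le (hPD : (prec blk Δ W (corner ℝ W)).PosDef) {μs vs : ℝ}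
    {w : {x : α // blk x ∈ W} → ℝ} (hμ : |w ⬝ᵥ ((prec blk Δ W (corner ℝ W))⁻¹ *ᵥ src blk ℱ W)| ≤ μs)
    (hv : w ⬝ᵥ ((prec blk Δ W (corner ℝ W))⁻¹ *ᵥ w) ≤ vs) (N : ℕ) :
    ∫ φ, |φ ⬝ᵥ w| ^ N ∂(fieldLaw blk Δ ℱ W) ≤ 2 ^ N * (μs ^ N + (1 + vs ^ N * ((2 * N - 1).doubleFactorial : ℝ))) := by
  haveI := isProbabilityMeasure_fieldLaw blk Δ ℱ W hPD
  obtain ⟨hm, hvar⟩ := integral_and_variance_dotProduct_fieldLaw blk Δ ℱ W hPD w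
  set A := prec blk Δ W (corner ℝ W) with hA
  have h := integral_abs_pow_le_of_hasGaussianLaw (hasGaussianLaw_dotProduct_fieldLaw blk Δ ℱ W hPD w) N
  rw [hm, hvar] at h
  have hv0 : 0 ≤ w ⬝ᵥ (A⁻¹ *ᵥ w) := by rw [← hvar]; exact variance_nonneg _ _
  have h1 : |w ⬝ᵥ (A⁻¹ *ᵥ src blk ℱ W)| ^ N ≤ μs ^ N := pow_le_pow_left₀ (abs_nonneg _) hμ N
  have h2 : (w ⬝ᵥ (A⁻¹ *ᵥ w)) ^ N * ((2 * N - 1).doubleFactorial : ℝ) ≤ vs ^ N * ((2 * N - 1).doubleFactorial : ℝ) :=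
    mul_le_mul_of_nonneg_right (pow_le_pow_left₀ hv0 hv N) (Nat.cast_nonneg _)
  exact h.trans (mul_le_mul_of_nonneg_left (by linarith) (pow_nonneg zero_le_two _))

/-- integrability of `|Φ·w|^N` under the law (all moments of a Gaussian are finite).
[cite: BalabanImbrieJaffe1988, §5.14 p.312] -/
theorem integrable_abs_dotProduct_pow_fieldLaw (hPD : (prec blk Δ W (corner ℝ W)).PosDef)
    (w : {x : α // blk x ∈ W} → ℝ) (N : ℕ) :
    Integrable (fun φ : {x : α // blk x ∈ W} → ℝ => |φ ⬝ᵥ w| ^ N) (fieldLaw blk Δ ℱ W) := by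
  haveI := isGaussian_fieldLaw blk Δ ℱ W hPD
  have hL := IsGaussian.memLp_dual (fieldLaw blk Δ ℱ W)
    (LinearMap.toContinuousLinearMap ((isLinearMap_dotProduct_right w).mk' _)) (N : ENNReal) ENNReal.coe_ne_top
  refine hL.integrable_norm_pow'.congr (ae_of_all _ fun φ => ?_)
  simp only [Real.norm_eq_abs, LinearMap.coe_toContinuousLinearMap', IsLinearMap.mk'_apply]

/-- **THE MOMENT LETTER `Λ_O` DISCHARGED**: for the observables `O`, if every observable leg and every vertex leg `w`
satisfies `|w·(prec⁻¹ℱ|_W)| ≤ μ_*` and `w·prec⁻¹w ≤ v_*` (`μ_* ≥ 0`), then every no-block term `t` of `expand 0 O` obeys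
`𝔼_W|Π_{w ∈ pending legs of t}(Φ·w)| ≤ Λ_O := Σ_{N ≤ Φ₀(O)} 2^N(μ_*^N + 1 + v_*^N(2N−1)‼)` — the hypothesis `hmom` of
`BIJ88WalkRemainderExpectation312.remainder_expectation_le`. [cite: BalabanImbrieJaffe1988, §5.14 p.312] -/
theorem remainder_moment_le (hPD : (prec blk Δ W (corner ℝ W)).PosDef)
    {Cov : P → Matrix {x : α // blk x ∈ W} {x : α // blk x ∈ W} ℝ} {trig : P → Bool} {c : ι → ℝ}
    {legs : ι → List ({x : α // blk x ∈ W} → ℝ)} {obs : κ → List ({x : α // blk x ∈ W} → ℝ)} {M : ℕ}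
    {μs vs : ℝ} (hμs : 0 ≤ μs) (hvs : 0 ≤ vs)
    (hobs : ∀ j, ∀ w ∈ obs j, |w ⬝ᵥ ((prec blk Δ W (corner ℝ W))⁻¹ *ᵥ src blk ℱ W)| ≤ μs ∧
      w ⬝ᵥ ((prec blk Δ W (corner ℝ W))⁻¹ *ᵥ w) ≤ vs)
    (hlegs : ∀ m, ∀ w ∈ legs m, |w ⬝ᵥ ((prec blk Δ W (corner ℝ W))⁻¹ *ᵥ src blk ℱ W)| ≤ μs ∧
      w ⬝ᵥ ((prec blk Δ W (corner ℝ W))⁻¹ *ᵥ w) ≤ vs)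
    (O : Finset κ) :
    ∀ t ∈ expand Cov trig (src blk ℱ W) c legs obs M 0 O, t.consts = 0 →
      ∫ φ, |((t.groups.map fun h => (h.pend : Multiset _)).sum.map fun w => φ ⬝ᵥ w).prod| ∂(fieldLaw blk Δ ℱ W)
        ≤ ∑ N ∈ range (phi0 legs obs M O + 1), 2 ^ N * (μs ^ N + (1 + vs ^ N * ((2 * N - 1).doubleFactorial : ℝ))) := by
  haveI := isProbabilityMeasure_fieldLaw blk Δ ℱ W hPD
  intro t ht _
  set Dir : Set ({x : α // blk x ∈ W} → ℝ) := {w | |w ⬝ᵥ ((prec blk Δ W (corner ℝ W))⁻¹ *ᵥ src blk ℱ W)| ≤ μs ∧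
      w ⬝ᵥ ((prec blk Δ W (corner ℝ W))⁻¹ *ᵥ w) ≤ vs} with hDir
  have hpend : ∀ X ∈ t.groups, ∀ w ∈ X.pend, w ∈ Dir := fun X hX w hw =>
    expand_pend_dir (Dir := Dir) (Cov := Cov) (trig := trig) (f := src blk ℱ W) (c := c) (M := M)
      (fun j w hw => hobs j w hw) (fun m w hw => hlegs m w hw) _ 0 O (Nat.lt_succ_self _)
      (fun h hh => absurd hh (Multiset.notMem_zero h)) t ht X (Multiset.mem_add.2 (Or.inr hX)) w hw
  obtain ⟨L, hL⟩ := Quot.exists_rep ((t.groups.map fun h => (h.pend : Multiset ({x : α // blk x ∈ W} → ℝ))).sum)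
  rw [Multiset.quot_mk_to_coe''] at hL
  have hmem : ∀ w ∈ L, w ∈ Dir := fun w hw => by
    have hw' : w ∈ (t.groups.map fun h => (h.pend : Multiset _)).sum := by rw [← hL]; exact Multiset.mem_coe.2 hw
    change w ∈ Multiset.join _ at hw'
    rw [Multiset.mem_join] at hw'
    obtain ⟨m, hm, hw'⟩ := hw'
    rw [Multiset.mem_map] at hm
    obtain ⟨X, hX, rfl⟩ := hm
    exact hpend X hX w (Multiset.mem_coe.1 hw')
  have hN : L.length ≤ phi0 legs obs M O := by
    have h := expand_pend_length_le_phi0 (Cov := Cov) (trig := trig) (c := c) O t ht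
    rw [← card_pend_sum, ← hL, Multiset.coe_card] at h
    exact h
  have hterm : ∀ N ∈ range (phi0 legs obs M O + 1), 0 ≤ (2 : ℝ) ^ N * (μs ^ N + (1 + vs ^ N * ((2 * N - 1).doubleFactorial : ℝ))) :=
    fun N _ => by positivity
  rw [← hL]
  simp only [Multiset.map_coe, Multiset.prod_coe]
  refine le_trans ?_ (Finset.single_le_sum hterm (mem_range.2 (Nat.lt_succ_of_le hN)))
  by_cases hnil : L = []
  · subst hnil
    simp
  · exact integral_abs_listProd_dotProduct_le L hnil
      (fun w _ => integrable_abs_dotProduct_pow_fieldLaw blk Δ ℱ W hPD w L.length)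
      (fun w hw => integral_abs_dotProduct_pow_fieldLaw_le blk Δ ℱ W hPD (hmem w hw).1 (hmem w hw).2 L.length)

/-! ## §5  The head's expectation clause from the sup letter alone -/

/-- **THE EXPECTATION CLAUSE `hE` OF THE HEAD FROM THE SUP LETTER ALONE**:
`BIJ88WalkRemainderExpectation312.remainder_expectation_le` with its moment hypothesis DISCHARGED by `remainder_moment_le` —
for the sup letter `|(Π_D∂)χ·e^{−V}| ≤ K_χ·Π_{z∈D}(η_χ‖z‖)` and legs with `|w·(prec⁻¹ℱ|_W)| ≤ μ_*`, `w·prec⁻¹w ≤ v_*`: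
`|𝔼_W[Π_{pending}(Φ·w)·(Π_{dirs t}∂)χ·e^{−V}]| ≤ K_χ·Π_{z∈dirs t}(η_χ‖z‖)·Λ_O` for every no-block term of `expand 0 O`.
[cite: BalabanImbrieJaffe1988, §5.14 p.312] -/
theorem remainder_expectation_le_of_sup (hPD : (prec blk Δ W (corner ℝ W)).PosDef)
    {Cov : P → Matrix {x : α // blk x ∈ W} {x : α // blk x ∈ W} ℝ} {trig : P → Bool} {c : ι → ℝ}
    {legs : ι → List ({x : α // blk x ∈ W} → ℝ)} {obs : κ → List ({x : α // blk x ∈ W} → ℝ)} {M : ℕ}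
    {χ : ({x : α // blk x ∈ W} → ℝ) → ℝ} {Kχ ηχ μs vs : ℝ} (hKχ : 0 ≤ Kχ) (hη0 : 0 ≤ ηχ) (hμs : 0 ≤ μs) (hvs : 0 ≤ vs)
    (hχc : ∀ D : List ({x : α // blk x ∈ W} → ℝ), Continuous (dlist D χ))
    (hK : ∀ (D : List ({x : α // blk x ∈ W} → ℝ)) φ, |dlist D χ φ * vexp c legs φ| ≤ Kχ * (D.map fun z => ηχ * ‖z‖).prod)
    (hobs : ∀ j, ∀ w ∈ obs j, |w ⬝ᵥ ((prec blk Δ W (corner ℝ W))⁻¹ *ᵥ src blk ℱ W)| ≤ μs ∧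
      w ⬝ᵥ ((prec blk Δ W (corner ℝ W))⁻¹ *ᵥ w) ≤ vs)
    (hlegs : ∀ m, ∀ w ∈ legs m, |w ⬝ᵥ ((prec blk Δ W (corner ℝ W))⁻¹ *ᵥ src blk ℱ W)| ≤ μs ∧
      w ⬝ᵥ ((prec blk Δ W (corner ℝ W))⁻¹ *ᵥ w) ≤ vs)
    (O : Finset κ) :
    ∀ t ∈ expand Cov trig (src blk ℱ W) c legs obs M 0 O, t.consts = 0 →
      |∫ φ, ((t.groups.map fun h => (h.pend : Multiset _)).sum.map fun w => φ ⬝ᵥ w).prod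
          * (dlist t.dirs χ φ * vexp c legs φ) ∂(fieldLaw blk Δ ℱ W)|
        ≤ Kχ * (t.dirs.map fun z => ηχ * ‖z‖).prod
          * ∑ N ∈ range (phi0 legs obs M O + 1), 2 ^ N * (μs ^ N + (1 + vs ^ N * ((2 * N - 1).doubleFactorial : ℝ))) :=
  remainder_expectation_le hPD hKχ hη0 hχc hK (remainder_moment_le blk Δ ℱ W hPD hμs hvs hobs hlegs O)

end Law

end Literature.MathematicalPhysics.QuantumFieldTheory.BalabanImbrieJaffe1984to88.BIJ88WalkRemainderMoments312

end
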